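import Literature.AlgebraicGeometry.Motives.ComplexAutGaloisDescent
import HarnessLib

/-!
# [Milne 2005, Prop. 13.1] for ISOMORPHISMS: an `Aut(ℂ/K)`-equivariant isomorphism `X_ℂ ≅ Y_ℂ` of the base changes of two
# `K`-schemes (`K ⊆ ℂ` countable) is the base change of a unique isomorphism `X ≅ Y` — with the weak hypotheses
# «`X_ℂ`, `Y_ℂ` reduced; `X`, `Y` separated over `K`» (no smoothness, no projectivity)

Topic `AlgebraicGeometry/Motives`; namespace `Literature.AlgebraicGeometry.Motives.GaloisDescent`.  Continuation of
`ComplexAutGaloisDescent.lean` (`existsUnique_map_eq_complex`: [Milne2005ShimuraVarieties] Prop. 13.1 for MORPHISMS — «a regular map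
`V_Ω → W_Ω` commuting with the actions of `Aut(Ω/k)` … arises from a unique regular map `V → W`», `Ω = ℂ`, `k = K` countable — proved
there for `X_ℂ` reduced and `Y` separated).  Here: the same for ISOMORPHISMS, by applying the morphism statement to `g` and to `g⁻¹`
(the inverse of an equivariant isomorphism is equivariant, `forall_gal_comp_inv_left`) and recognising `f ≫ f′ = 𝟙`, `f′ ≫ f = 𝟙` after
the faithful base change `Spec ℂ → Spec K` (`AbelianVariety.bcFunctor_map_injective`).  This is the «13.1 for isos» input (D1-aux) of the
cell hodgecm-mathlib's row I-6 (`descentToIntersection_printed`, [Deligne1971TravauxShimura] Prop. 5.10 / Cor. 5.5): the comparison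
isomorphisms between two `E′`-models of a canonical model are recognised over `E′` from their `Aut(ℂ/E′)`-equivariance.

* `forall_gal_comp_inv_left` — equivariance of `g.inv` from that of `g.hom`;
* **`exists_iso_map_eq_of_forall_gal_comp_of_isReduced`** — `∃ f : X ≅ Y, (bcFunctor K ℂ).map f.hom = g.hom` (the pinned shape);
* `existsUnique_iso_mapIso_eq_of_forall_gal_comp` — `∃! f : X ≅ Y, (bcFunctor K ℂ).mapIso f = g`;
* riders: `eq_hom_of_map_eq` (any `f′` with `(f′)_ℂ = g.hom` is `f.hom`), `map_inv_eq_of_map_hom_eq` (`(f.inv)_ℂ = g.inv`).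

Theorems only; NO named fact, NO instance, NO `sorry`; net Literature debt 0.  HC_CM is not proved here.

## References
* [Milne2005ShimuraVarieties] J. S. Milne, *Introduction to Shimura varieties* (2005), §13 Prop. 13.1 p. 117 L5–13 (morphisms commuting
  with `Aut(Ω/k)` descend), proof of Thm. 13.6 p. 118 L29, Thm. 13.7 (a) p. 119 (uniqueness of canonical models up to unique isomorphism).
* [Deligne1971TravauxShimura] P. Deligne, *Travaux de Shimura*, Sém. Bourbaki 389 (1971), Cor. 5.5, Prop. 5.10 and Lemme 5.10.1.
* [GortzWedhorn2020] U. Görtz, T. Wedhorn, *Algebraic Geometry I*, 2nd ed., Thm. 14.72 (1) (descent of morphisms), §(14.20).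
* Tree: `Motives.ComplexAutGaloisDescent` (`GaloisDescent.existsUnique_map_eq_complex`), `Motives.JacobianGaloisDescent`
  (`GaloisDescent.gal`, `bc`), `Motives.AbelianVarietyEndGaloisDescent` (`AbelianVariety.bcFunctor_map_injective`).
-/

set_option autoImplicit false

noncomputable section

open CategoryTheory CategoryTheory.Limits AlgebraicGeometry Cardinal

namespace Literature.AlgebraicGeometry.Motives

namespace GaloisDescent

open AbelianVariety (bcSpec bcFunctor bcFunctor_map_injective)

set_option backward.isDefEq.respectTransparency false

variable {K : Type} [Field K] [Algebra K ℂ]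

/-- **The inverse of an `Aut(ℂ/K)`-equivariant isomorphism `X_ℂ ≅ Y_ℂ` is equivariant**: `gal_Y σ ≫ g⁻¹ = g⁻¹ ≫ gal_X σ` from
`gal_X σ ≫ g = g ≫ gal_Y σ` (cancel the isomorphism `g`). [cite: GortzWedhorn2020, §(14.20)] [cite: Milne2005ShimuraVarieties, §13 Prop. 13.1 p. 117] -/
theorem forall_gal_comp_inv_left {X Y : SchemeOver K} (g : (bcFunctor K ℂ).obj X ≅ (bcFunctor K ℂ).obj Y)
    (hg : ∀ σ : ℂ ≃ₐ[K] ℂ, gal ℂ X σ ≫ g.hom.left = g.hom.left ≫ gal ℂ Y σ) (σ : ℂ ≃ₐ[K] ℂ) :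
    gal ℂ Y σ ≫ g.inv.left = g.inv.left ≫ gal ℂ X σ := by
  have h1 : g.hom.left ≫ g.inv.left = 𝟙 _ := by rw [← Over.comp_left, Iso.hom_inv_id, Over.id_left]
  haveI : IsIso g.hom.left := inferInstance
  rw [← cancel_epi g.hom.left, reassoc_of% h1, ← reassoc_of% (hg σ), h1]
  exact Category.comp_id _

/-- **[Milne 2005, Prop. 13.1] for isomorphisms, weak hypotheses.**  Let `K` be a countable field with `K → ℂ`, and `X`, `Y` two
`K`-schemes, separated over `K`, with `X_ℂ = X ×_K Spec ℂ` and `Y_ℂ` reduced.  Every isomorphism `g : X_ℂ ≅ Y_ℂ` over `ℂ` commuting with the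
automorphisms `1 × Spec σ⁻¹`, `σ ∈ Aut(ℂ/K)`, is the base change of an isomorphism `f : X ≅ Y` over `K` (apply Prop. 13.1 for morphisms,
`existsUnique_map_eq_complex`, to `g` and to `g⁻¹`; the two descended morphisms are mutually inverse because their base changes are and
base change along `Spec ℂ → Spec K` is faithful).  No smoothness or projectivity is assumed.
[cite: Milne2005ShimuraVarieties, §13 Prop. 13.1 p. 117 L5–13 and Thm. 13.7 (a) p. 119] [cite: GortzWedhorn2020, Thm. 14.72 (1)] -/
theorem exists_iso_map_eq_of_forall_gal_comp_of_isReduced (hK : #K ≤ ℵ₀) (X Y : SchemeOver K)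
    [IsReduced (bc ℂ X)] [IsReduced (bc ℂ Y)] [IsSeparated X.hom] [IsSeparated Y.hom]
    (g : (bcFunctor K ℂ).obj X ≅ (bcFunctor K ℂ).obj Y)
    (hg : ∀ σ : ℂ ≃ₐ[K] ℂ, gal ℂ X σ ≫ g.hom.left = g.hom.left ≫ gal ℂ Y σ) :
    ∃ f : X ≅ Y, (bcFunctor K ℂ).map f.hom = g.hom := by
  obtain ⟨f, hf, -⟩ := existsUnique_map_eq_complex hK g.hom hg
  obtain ⟨f', hf', -⟩ := existsUnique_map_eq_complex hK g.inv (forall_gal_comp_inv_left g hg)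
  refine ⟨⟨f, f', ?_, ?_⟩, hf⟩
  · apply bcFunctor_map_injective ℂ
    rw [CategoryTheory.Functor.map_comp, hf, hf', Iso.hom_inv_id, CategoryTheory.Functor.map_id]
  · apply bcFunctor_map_injective ℂ
    rw [CategoryTheory.Functor.map_comp, hf, hf', Iso.inv_hom_id, CategoryTheory.Functor.map_id]

/-- **Uniqueness rider**: a `K`-morphism whose base change is `g.hom` IS the descended isomorphism's `hom` (faithfulness of base change);
in particular the isomorphism of `exists_iso_map_eq_of_forall_gal_comp_of_isReduced` is unique. [cite: Milne2005ShimuraVarieties, §13 Prop. 13.1 p. 117 L5–13] -/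
theorem eq_hom_of_map_eq {X Y : SchemeOver K} (g : (bcFunctor K ℂ).obj X ≅ (bcFunctor K ℂ).obj Y) (f : X ≅ Y)
    (hf : (bcFunctor K ℂ).map f.hom = g.hom) (f' : X ⟶ Y) (hf' : (bcFunctor K ℂ).map f' = g.hom) : f' = f.hom :=
  bcFunctor_map_injective ℂ (hf'.trans hf.symm)

/-- The descended isomorphism base-changes to `g` as an isomorphism: `(bcFunctor K ℂ).mapIso f = g`.
[cite: Milne2005ShimuraVarieties, §13 Prop. 13.1 p. 117 L5–13] -/
theorem mapIso_eq_of_map_hom_eq {X Y : SchemeOver K} (g : (bcFunctor K ℂ).obj X ≅ (bcFunctor K ℂ).obj Y) (f : X ≅ Y)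
    (hf : (bcFunctor K ℂ).map f.hom = g.hom) : (bcFunctor K ℂ).mapIso f = g :=
  Iso.ext hf

/-- The inverse of the descended isomorphism base-changes to `g⁻¹`. [cite: Milne2005ShimuraVarieties, §13 Prop. 13.1 p. 117 L5–13] -/
theorem map_inv_eq_of_map_hom_eq {X Y : SchemeOver K} (g : (bcFunctor K ℂ).obj X ≅ (bcFunctor K ℂ).obj Y) (f : X ≅ Y)
    (hf : (bcFunctor K ℂ).map f.hom = g.hom) : (bcFunctor K ℂ).map f.inv = g.inv := by
  rw [← Functor.mapIso_inv, mapIso_eq_of_map_hom_eq g f hf]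

/-- **[Milne 2005, Prop. 13.1 / Thm. 13.7 (a)] for isomorphisms, `∃!` form**: under the hypotheses of
`exists_iso_map_eq_of_forall_gal_comp_of_isReduced` there is a UNIQUE `f : X ≅ Y` with `(bcFunctor K ℂ).mapIso f = g`.
[cite: Milne2005ShimuraVarieties, §13 Prop. 13.1 p. 117 L5–13 and Thm. 13.7 (a) p. 119] [cite: Deligne1971TravauxShimura, Cor. 5.5] -/
theorem existsUnique_iso_mapIso_eq_of_forall_gal_comp (hK : #K ≤ ℵ₀) (X Y : SchemeOver K)
    [IsReduced (bc ℂ X)] [IsReduced (bc ℂ Y)] [IsSeparated X.hom] [IsSeparated Y.hom]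
    (g : (bcFunctor K ℂ).obj X ≅ (bcFunctor K ℂ).obj Y)
    (hg : ∀ σ : ℂ ≃ₐ[K] ℂ, gal ℂ X σ ≫ g.hom.left = g.hom.left ≫ gal ℂ Y σ) :
    ∃! f : X ≅ Y, (bcFunctor K ℂ).mapIso f = g := by
  obtain ⟨f, hf⟩ := exists_iso_map_eq_of_forall_gal_comp_of_isReduced hK X Y g hg
  refine ⟨f, mapIso_eq_of_map_hom_eq g f hf, fun f' hf' ↦ Iso.ext ?_⟩
  exact eq_hom_of_map_eq g f hf f'.hom (by rw [← Functor.mapIso_hom, hf'])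

/-- **The same with the uniqueness clause spelled on morphisms** (the rider asked by the consumer): `∃ f : X ≅ Y` with
`(f.hom)_ℂ = g.hom`, `(f.inv)_ℂ = g.inv`, and every `f′ : X ⟶ Y` with `(f′)_ℂ = g.hom` equals `f.hom`.
[cite: Milne2005ShimuraVarieties, §13 Prop. 13.1 p. 117 L5–13 and Thm. 13.7 (a) p. 119] -/
theorem exists_iso_map_eq_and_unique_of_forall_gal_comp (hK : #K ≤ ℵ₀) (X Y : SchemeOver K)
    [IsReduced (bc ℂ X)] [IsReduced (bc ℂ Y)] [IsSeparated X.hom] [IsSeparated Y.hom]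
    (g : (bcFunctor K ℂ).obj X ≅ (bcFunctor K ℂ).obj Y)
    (hg : ∀ σ : ℂ ≃ₐ[K] ℂ, gal ℂ X σ ≫ g.hom.left = g.hom.left ≫ gal ℂ Y σ) :
    ∃ f : X ≅ Y, (bcFunctor K ℂ).map f.hom = g.hom ∧ (bcFunctor K ℂ).map f.inv = g.inv ∧
      ∀ f' : X ⟶ Y, (bcFunctor K ℂ).map f' = g.hom → f' = f.hom := by
  obtain ⟨f, hf⟩ := exists_iso_map_eq_of_forall_gal_comp_of_isReduced hK X Y g hg
  exact ⟨f, hf, map_inv_eq_of_map_hom_eq g f hf, fun f' hf' ↦ eq_hom_of_map_eq g f hf f' hf'⟩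

end GaloisDescent

end Literature.AlgebraicGeometry.Motives

end
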